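import Literature.NumberTheory.QuadraticFields.DedekindZetaReducedForms
import HarnessLib

/-!
# Partial sums of the Dedekind zeta function of an imaginary quadratic field, class by class,
# against lattice sums over the reduced forms

Topic `NumberTheory/QuadraticFields`, namespace `Literature.NumberTheory.QuadraticFields.Quadratic`
(continuing `FormIdeals.lean`, `FormIdealsStructure.lean` and the form–ideal dictionary of
`Literature/NumberTheory/EllipticCurves/HeegnerPointsClass*Proofs.lean`).  Everything here is PROVED
(theorems only; no definitions, no named facts).

Let `K` be an imaginary quadratic field, `D = d_K`, `(1, ω)` an integral basis with `ω² = m + tω`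
(`D = t² + 4m`), and for a form `Q = (A, B, C)` of discriminant `D` let
`𝔞_Q = (A, ω − (B + t)/2) = ℤA ⊕ ℤ(−B + √D)/2` be its ideal (Cox, *Primes of the form x² + ny²*,
Thm. 7.7).  The main result `sum_card_absNorm_eq_div_le` bounds the harmonic partial sums of the
ideal-counting function `a_K(n) = #{𝔞 : N𝔞 = n}` (the coefficients of `ζ_K`) by lattice sums over
the reduced forms of discriminant `D`:

  if `∑_{v ∈ T} 1/Q(v) ≤ B(Q)` for every `Q ∈ reducedForms D` and every finite set `T` of non-zero
  lattice points with `Q(v) ≤ N`, then `∑_{n ≤ N} a_K(n)/n ≤ ½ ∑_{Q ∈ reducedForms D} B(Q)`.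

This is the classical passage "the number of ideals of norm `n` in a class is `1/w` times the
number of representations of `n` by the corresponding form" (Davenport, *Multiplicative Number
Theory*, Ch. 6, (2)–(4); Cox, Thm. 7.7 and (7.16); Goldfeld–Schinzel 1975, §2), in the one-sided
form that needs neither the exact unit count nor injectivity of `Q ↦ [𝔞_Q]`:

* `N(A, ω − k) = A` (`absNorm_span_pair_eq`) and `N(uA + v(ω − k)) = A · (Au² + (t − 2k)uv + Cv²)`
  (`norm_lattice_elt`, both from `IdealClassEpsteinSum.lean`), i.e. `N(λ) = N(𝔞_Q) · Q(u, −v)`;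
* ideals `𝔞` with `[𝔞] = [𝔞_Q]⁻¹` and `N𝔞 ≤ N` are `𝔞 = (λ)𝔞_Q⁻¹` with `λ ∈ 𝔞_Q ∖ 0`
  (Mathlib `ClassGroup.mk0_eq_mk0_inv_iff`), `Q(u, −v) = N𝔞 ≤ N`; the map `(𝔞, ±) ↦ ±(u, −v)` is
  injective, whence `∑_{[𝔞] = [𝔞_Q]⁻¹, N𝔞 ≤ N} 1/N𝔞 ≤ ½ B(Q)` (no unit count needed);
* every class is `[𝔞_Q]⁻¹` for some REDUCED `Q` (`reducedForms_mk0_bijective`,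
  `DedekindZetaReducedForms.lean`: Cox Thm. 7.7(ii)), so summing over `reducedForms D` covers every
  class (exactly once, though only "at least once" is used).

The companion identity for the full Dirichlet series, `ζ_K(s) = ½ ∑_{Q reduced} Z_Q(s)`
(`dedekindZeta_eq_half_sum_epsteinZeta`), lives in `DedekindZetaReducedForms.lean`; the present
file is its truncated, real-variable, inequality form, which is what elementary Siegel-zero
arguments consume (Goldfeld–Schinzel 1975, §3).

## References

* H. Davenport, *Multiplicative Number Theory*, 2nd ed., GTM 74 (1980), Ch. 6. [DavenportMNT1980]
* D. A. Cox, *Primes of the form x² + ny²*, 2nd ed. (2013), §7.B Thm. 7.7, (7.16). [Cox2013]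
* D. M. Goldfeld, A. Schinzel, *On Siegel's zero*, Ann. Scuola Norm. Sup. Pisa (4) 2 (1975), §2.
-/

noncomputable section

open scoped MatrixGroups nonZeroDivisors
open Module NumberField Finset
open Literature.NumberTheory.EllipticCurves
open Literature.NumberTheory.QuadraticFields.BinaryQuadraticForm (reducedForms mem_reducedForms_iff
  discr_apply le_of_isReduced)

namespace Literature.NumberTheory.QuadraticFields.Quadratic

variable {K : Type*} [Field K] [NumberField K]

/-! ### Partial sums of `ζ_K` against lattice sums -/

/-- **`∑_{n ≤ N} a_K(n)/n ≤ ½ ∑_{Q reduced} B(Q)`.**  Let `K` be an imaginary quadratic field,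
`D = d_K`, and suppose `B(Q)` bounds `∑_{v ∈ T} 1/Q(v)` for every reduced form `Q` of discriminant
`D` and every finite set `T` of non-zero lattice points `v` with `Q(v) ≤ N`.  Then the harmonic
partial sum of the number `a_K(n)` of ideals of norm `n` satisfies
`∑_{n ≤ N} a_K(n)/n ≤ ½ ∑_{Q ∈ reducedForms D} B(Q)`.  (Class by class: the ideals in the class
`[𝔞_Q]⁻¹` of norm `≤ N` are the `(λ)𝔞_Q⁻¹`, `λ = uA + v(ω − k) ∈ 𝔞_Q ∖ 0`, with
`N𝔞 · N𝔞_Q = N(λ) = A · Q(u, −v)` and `N𝔞_Q ≤ A`, so `Q(u, −v) ≤ N𝔞 ≤ N`; `λ` and `−λ` give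
distinct points, whence `∑ 1/N𝔞 ≤ ½ B(Q)`; and every class is `[𝔞_Q]⁻¹` with `Q` reduced,
`reducedForms_mk0_bijective`.)  Davenport, Ch. 6 (2)–(4): `r(n) = w ∑_{classes} R(n, Q)`,
here one-sided and without the unit count. [cite: DavenportMNT1980, Ch. 6] -/
theorem sum_card_absNorm_eq_div_le (hK : IsImaginaryQuadratic K) (N : ℕ) (B : ℤ × ℤ × ℤ → ℝ)
    (hB : ∀ Q ∈ reducedForms (NumberField.discr K), ∀ T : Finset (ℤ × ℤ),
      (∀ v ∈ T, v ≠ 0 ∧ Q.1 * v.1 ^ 2 + Q.2.1 * v.1 * v.2 + Q.2.2 * v.2 ^ 2 ≤ N) →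
        ∑ v ∈ T, (1 : ℝ) / (Q.1 * v.1 ^ 2 + Q.2.1 * v.1 * v.2 + Q.2.2 * v.2 ^ 2 : ℤ) ≤ B Q) :
    ∑ n ∈ Ioc 0 N, (Nat.card {I : Ideal (𝓞 K) // Ideal.absNorm I = n} : ℝ) / n ≤
      (1 / 2) * ∑ Q ∈ reducedForms (NumberField.discr K), B Q := by
  classical
  -- integral basis and discriminant
  obtain ⟨b, hb⟩ := exists_basis_zero_eq_one (K := K) hK.1
  set m : ℤ := b.repr (b 1 * b 1) 0 with hm
  set t : ℤ := b.repr (b 1 * b 1) 1 with ht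
  have hω : b 1 * b 1 = (m : 𝓞 K) + (t : 𝓞 K) * b 1 := basis_one_mul_self_eq b hb
  have hDK : NumberField.discr K = t ^ 2 + 4 * m := discr_eq_sq_add_four_mul b hb
  have hneg : t ^ 2 + 4 * m < 0 := hDK ▸ hK.discr_neg
  set D : ℤ := NumberField.discr K with hDdef
  have hD0 : D < 0 := hK.discr_neg
  /- 1. `∑_{n ≤ N} a_K(n)/n = ∑_{0 < N𝔞 ≤ N} 1/N𝔞` -/
  set 𝓘 : Finset (Ideal (𝓞 K)) :=
    (Ideal.finite_setOf_absNorm_le (S := 𝓞 K) N).toFinset.filter (fun I => I ≠ ⊥) with h𝓘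
  have hmem𝓘 : ∀ {I : Ideal (𝓞 K)}, I ∈ 𝓘 ↔ I ≠ ⊥ ∧ Ideal.absNorm I ≤ N := by
    intro I
    rw [h𝓘, mem_filter, Set.Finite.mem_toFinset, Set.mem_setOf_eq, and_comm]
  have hLHS : ∑ n ∈ Ioc 0 N, (Nat.card {I : Ideal (𝓞 K) // Ideal.absNorm I = n} : ℝ) / n =
      ∑ I ∈ 𝓘, (1 : ℝ) / (Ideal.absNorm I : ℝ) := by
    have hmaps : ∀ I ∈ 𝓘, Ideal.absNorm I ∈ Ioc 0 N := by
      intro I hI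
      obtain ⟨hI0, hIN⟩ := hmem𝓘.1 hI
      exact mem_Ioc.2 ⟨Nat.pos_of_ne_zero (mt Ideal.absNorm_eq_zero_iff.1 hI0), hIN⟩
    rw [← sum_fiberwise_of_maps_to hmaps]
    refine sum_congr rfl fun n hn => ?_
    obtain ⟨hn0, hnN⟩ := mem_Ioc.1 hn
    have hfib : ∀ I ∈ 𝓘.filter (fun I => Ideal.absNorm I = n),
        (1 : ℝ) / (Ideal.absNorm I : ℝ) = 1 / n := by
      intro I hI
      rw [(mem_filter.1 hI).2]
    rw [sum_congr rfl hfib, sum_const, nsmul_eq_mul, div_eq_mul_one_div]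
    congr 1
    -- the fibre is the set of ideals of norm `n`
    have hfin : ({I : Ideal (𝓞 K) | Ideal.absNorm I = n} : Set _).Finite :=
      Ideal.finite_setOf_absNorm_eq n
    have hset : 𝓘.filter (fun I => Ideal.absNorm I = n) = hfin.toFinset := by
      ext I
      rw [mem_filter, hmem𝓘, Set.Finite.mem_toFinset, Set.mem_setOf_eq]
      constructor
      · exact fun h => h.2
      · intro h
        refine ⟨⟨fun h0 => ?_, h ▸ hnN⟩, h⟩
        rw [h0] at h
        have : Ideal.absNorm (⊥ : Ideal (𝓞 K)) = 0 := Ideal.absNorm_eq_zero_iff.2 rfl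
        omega
    have hcard : Nat.card {I : Ideal (𝓞 K) // Ideal.absNorm I = n} = hfin.toFinset.card := by
      rw [← Set.ncard_eq_toFinset_card _ hfin, ← Nat.card_coe_set_eq]
      rfl
    rw [hcard, hset]
  rw [hLHS]
  /- 2. decomposition by ideal classes -/
  let cls : Ideal (𝓞 K) → ClassGroup (𝓞 K) := fun I =>
    if h : I = ⊥ then 1 else ClassGroup.mk0 ⟨I, mem_nonZeroDivisors_of_ne_zero (by simpa using h)⟩
  let G : ClassGroup (𝓞 K) → ℝ := fun c =>
    ∑ I ∈ 𝓘.filter (fun I => cls I = c), (1 : ℝ) / (Ideal.absNorm I : ℝ)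
  have hG0 : ∀ c, 0 ≤ G c := fun c => sum_nonneg fun I _ => by positivity
  have hdecomp : ∑ I ∈ 𝓘, (1 : ℝ) / (Ideal.absNorm I : ℝ) = ∑ c : ClassGroup (𝓞 K), G c :=
    (sum_fiberwise_of_maps_to (g := cls) (fun I _ => mem_univ (cls I)) _).symm
  rw [hdecomp]
  /- 3. the ideal of a reduced form and its class -/
  let 𝔟 : ℤ × ℤ × ℤ → Ideal (𝓞 K) := fun Q =>
    Ideal.span {(Q.1 : 𝓞 K), b 1 - (((Q.2.1 + t) / 2 : ℤ) : 𝓞 K)}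
  let cQ : ℤ × ℤ × ℤ → ClassGroup (𝓞 K) := fun Q =>
    if h : 0 < Q.1 then (ClassGroup.mk0 ⟨𝔟 Q, span_pair_mem_nonZeroDivisors b hb h.ne' _⟩)⁻¹ else 1
  have hsurj : ∀ c : ClassGroup (𝓞 K), ∃ Q ∈ reducedForms D, cQ Q = c := by
    intro c
    obtain ⟨⟨Q, hQ⟩, hc⟩ := (reducedForms_mk0_bijective b hb hω hneg).2 c⁻¹
    dsimp only at hc
    rw [← hDK] at hQ
    have hA : 0 < Q.1 := ((mem_reducedForms_iff hD0).1 hQ).2.1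
    refine ⟨Q, hQ, ?_⟩
    simp only [cQ, dif_pos hA]
    rw [inv_eq_iff_eq_inv, ← hc]
  have hstep : ∑ c : ClassGroup (𝓞 K), G c ≤ ∑ Q ∈ reducedForms D, G (cQ Q) := by
    rw [← sum_fiberwise_of_maps_to (s := reducedForms D) (t := (univ : Finset (ClassGroup (𝓞 K))))
      (g := cQ) (fun Q _ => mem_univ _)]
    refine sum_le_sum fun c _ => ?_
    obtain ⟨Q, hQ, hcQ⟩ := hsurj c
    have hmem : Q ∈ (reducedForms D).filter (fun Q => cQ Q = c) := mem_filter.2 ⟨hQ, hcQ⟩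
    calc G c = G (cQ Q) := by rw [hcQ]
      _ ≤ ∑ Q' ∈ (reducedForms D).filter (fun Q => cQ Q = c), G (cQ Q') :=
          single_le_sum (f := fun Q' => G (cQ Q')) (fun Q' _ => hG0 _) hmem
  refine hstep.trans ?_
  rw [mul_sum]
  refine sum_le_sum fun Q hQ => ?_
  /- 4. the class `[𝔞_Q]⁻¹`: `G (cQ Q) ≤ B(Q)/2` -/
  obtain ⟨hdiscQ, hA, -, -⟩ := (mem_reducedForms_iff hD0).1 hQ
  rw [discr_apply] at hdiscQ
  have h𝔟0 : 𝔟 Q ∈ (Ideal (𝓞 K))⁰ := span_pair_mem_nonZeroDivisors b hb hA.ne' _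
  have hcQ : cQ Q = (ClassGroup.mk0 ⟨𝔟 Q, h𝔟0⟩)⁻¹ := by simp only [cQ, dif_pos hA]
  set A : ℤ := Q.1 with hAdef
  set Bq : ℤ := Q.2.1 with hBdef
  set C : ℤ := Q.2.2 with hCdef
  set k : ℤ := (Bq + t) / 2 with hk
  have hdisc' : Bq ^ 2 - 4 * A * C = t ^ 2 + 4 * m := by rw [← hDK]; exact hdiscQ
  have h2k : 2 * k = Bq + t := two_mul_ediv_two_of_disc_eq hdisc'
  have hn : A * C = k ^ 2 - t * k - m := norm_eq_of_disc_eq hdisc' h2k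
  have h𝔟Q : 𝔟 Q = Ideal.span {(A : 𝓞 K), b 1 - (k : 𝓞 K)} := rfl
  have h𝔟ne : 𝔟 Q ≠ 0 := nonZeroDivisors.ne_zero h𝔟0
  -- the form
  set ev : ℤ × ℤ → ℤ := fun v => A * v.1 ^ 2 + Bq * v.1 * v.2 + C * v.2 ^ 2 with hev
  have hev_neg : ∀ v : ℤ × ℤ, ev (-v) = ev v := fun v => by
    simp only [hev, Prod.fst_neg, Prod.snd_neg]; ring
  have hev_nonneg : ∀ v : ℤ × ℤ, 0 ≤ ev v := fun v => by
    have e : 4 * A * ev v = (2 * A * v.1 + Bq * v.2) ^ 2 + (4 * A * C - Bq ^ 2) * v.2 ^ 2 := by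
      rw [hev]; ring
    have hq : 0 < 4 * A * C - Bq ^ 2 := by linarith
    nlinarith [sq_nonneg (2 * A * v.1 + Bq * v.2), sq_nonneg v.2]
  -- norms: `N𝔟 ≤ A`, `1 ≤ N𝔟`
  have hN𝔟le : (Ideal.absNorm (𝔟 Q) : ℤ) ≤ A := by
    rw [h𝔟Q, absNorm_span_pair_eq b hb hω hn, Int.natCast_natAbs, abs_of_pos hA]
  have hN𝔟pos : 0 < Ideal.absNorm (𝔟 Q) :=
    Nat.pos_of_ne_zero (mt Ideal.absNorm_eq_zero_iff.1 (by simpa using h𝔟ne))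
  -- the fibre and its generators
  set F : Finset (Ideal (𝓞 K)) := 𝓘.filter (fun I => cls I = cQ Q) with hF
  have hFmem : ∀ I ∈ F, I ≠ ⊥ ∧ Ideal.absNorm I ≤ N ∧ ∃ x : 𝓞 K, x ≠ 0 ∧ I * 𝔟 Q = Ideal.span {x} := by
    intro I hI
    obtain ⟨hI𝓘, hcls⟩ := mem_filter.1 hI
    obtain ⟨hI0, hIN⟩ := hmem𝓘.1 hI𝓘
    refine ⟨hI0, hIN, ?_⟩
    simp only [cls, dif_neg hI0, hcQ] at hcls
    obtain ⟨x, hx, hIx⟩ := ClassGroup.mk0_eq_mk0_inv_iff.1 hcls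
    exact ⟨x, hx, hIx⟩
  choose! gen hgen0 hgenI using fun I hI => (hFmem I hI).2.2
  -- lattice coordinates of the generators
  have hco : ∀ I ∈ F, ∃ uv : ℤ × ℤ, gen I = (uv.1 : 𝓞 K) * A + (uv.2 : 𝓞 K) * (b 1 - k) := by
    intro I hI
    have hmem : gen I ∈ 𝔟 Q := by
      have : gen I ∈ I * 𝔟 Q := by rw [hgenI I hI]; exact Ideal.mem_span_singleton_self _
      exact Ideal.mul_le_left this
    rw [h𝔟Q] at hmem
    obtain ⟨u, v, huv⟩ := (mem_span_pair_iff_of_basis b hb hω hn (gen I)).1 hmem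
    exact ⟨(u, v), huv⟩
  choose! co hco using hco
  -- the key arithmetic: `N I · N𝔟 = A · Q(u, −v)`
  have hnormI : ∀ I ∈ F, (Ideal.absNorm I : ℤ) * Ideal.absNorm (𝔟 Q) = A * ev ((co I).1, -(co I).2) := by
    intro I hI
    have h1 : Ideal.absNorm (I * 𝔟 Q) = (Algebra.norm ℤ (gen I)).natAbs := by
      rw [hgenI I hI, Ideal.absNorm_span_singleton]
    rw [map_mul] at h1
    have h2 : Algebra.norm ℤ (gen I) = A * ev ((co I).1, -(co I).2) := by
      rw [hco I hI, norm_lattice_elt b hb hω hn, hev]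
      simp only
      have hB : t - 2 * k = -Bq := by linarith
      rw [hB]; ring
    have h3 : ((Ideal.absNorm I * Ideal.absNorm (𝔟 Q) : ℕ) : ℤ) = |A * ev ((co I).1, -(co I).2)| := by
      rw [h1, h2, Int.natCast_natAbs]
    rw [abs_of_nonneg (mul_nonneg hA.le (hev_nonneg _))] at h3
    exact_mod_cast h3
  have hevI : ∀ I ∈ F, 1 ≤ ev ((co I).1, -(co I).2) ∧ ev ((co I).1, -(co I).2) ≤ Ideal.absNorm I := by
    intro I hI
    obtain ⟨hI0, hIN, -⟩ := hFmem I hI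
    have hNI : 0 < Ideal.absNorm I := Nat.pos_of_ne_zero (mt Ideal.absNorm_eq_zero_iff.1 hI0)
    have h := hnormI I hI
    have hNI' : (1 : ℤ) ≤ Ideal.absNorm I := by exact_mod_cast hNI
    have hN𝔟' : (1 : ℤ) ≤ Ideal.absNorm (𝔟 Q) := by exact_mod_cast hN𝔟pos
    constructor
    · -- `A · ev = N I · N𝔟 ≥ 1`, `A ≥ 1`
      by_contra hlt
      push Not at hlt
      have : A * ev ((co I).1, -(co I).2) ≤ 0 := by nlinarith [hev_nonneg ((co I).1, -(co I).2)]
      nlinarith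
    · -- `A · ev = N I · N𝔟 ≤ N I · A`
      nlinarith
  -- the injection `(I, ±) ↦ ±(u, −v)`
  let pt : Ideal (𝓞 K) × Bool → ℤ × ℤ := fun Is =>
    if Is.2 then ((co Is.1).1, -(co Is.1).2) else (-(co Is.1).1, (co Is.1).2)
  have hpt_ev : ∀ Is ∈ F ×ˢ (univ : Finset Bool), ev (pt Is) = ev ((co Is.1).1, -(co Is.1).2) := by
    rintro ⟨I, s⟩ -
    cases s
    · simp only [pt, Bool.false_eq_true, if_false, hev]
      ring
    · simp only [pt, if_true]
  have hinj : Set.InjOn pt ↑(F ×ˢ (univ : Finset Bool)) := by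
    rintro ⟨I, s⟩ hI ⟨J, s'⟩ hJ h
    rw [mem_coe, mem_product] at hI hJ
    have hIF : I ∈ F := hI.1
    have hJF : J ∈ F := hJ.1
    -- equal or opposite coordinates
    have hcases : co I = co J ∨ (co I).1 = -(co J).1 ∧ (co I).2 = -(co J).2 := by
      cases s <;> cases s' <;>
        simp only [pt, if_true, Bool.false_eq_true, if_false, Prod.mk.injEq] at h
      · exact Or.inl (Prod.ext (by linarith [h.1]) (by linarith [h.2]))
      · exact Or.inr ⟨by linarith [h.1], by linarith [h.2]⟩
      · exact Or.inr ⟨by linarith [h.1], by linarith [h.2]⟩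
      · exact Or.inl (Prod.ext (by linarith [h.1]) (by linarith [h.2]))
    have hcancel : ∀ {I J : Ideal (𝓞 K)}, I ∈ F → J ∈ F →
        Ideal.span {gen I} = Ideal.span {gen J} → I = J := by
      intro I J hI hJ hIJ
      have : I * 𝔟 Q = J * 𝔟 Q := by rw [hgenI I hI, hgenI J hJ, hIJ]
      exact mul_right_cancel₀ h𝔟ne this
    rcases hcases with hc | ⟨hc1, hc2⟩
    · -- same point, same ideal, same sign
      have hIJ : I = J := hcancel hIF hJF (by rw [hco I hIF, hco J hJF, hc])
      subst hIJ
      cases s <;> cases s' <;>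
        simp only [pt, if_true, Bool.false_eq_true, if_false, Prod.mk.injEq] at h ⊢
      · have h1 := (hevI I hIF).1
        exfalso
        have hz : (co I).1 = 0 ∧ (co I).2 = 0 := ⟨by linarith [h.1], by linarith [h.2]⟩
        have : ev ((co I).1, -(co I).2) = 0 := by rw [hev]; simp [hz.1, hz.2]
        omega
      · have h1 := (hevI I hIF).1
        exfalso
        have hz : (co I).1 = 0 ∧ (co I).2 = 0 := ⟨by linarith [h.1], by linarith [h.2]⟩
        have : ev ((co I).1, -(co I).2) = 0 := by rw [hev]; simp [hz.1, hz.2]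
        omega
    · -- opposite points: `gen I = -gen J`, same ideal, hence `gen I = 0`: impossible
      have hgIJ : gen I = -gen J := by
        have hc1' : (((co I).1 : ℤ) : 𝓞 K) = -(((co J).1 : ℤ) : 𝓞 K) := by exact_mod_cast hc1
        have hc2' : (((co I).2 : ℤ) : 𝓞 K) = -(((co J).2 : ℤ) : 𝓞 K) := by exact_mod_cast hc2
        rw [hco I hIF, hco J hJF, hc1', hc2']; ring
      have hIJ : I = J := hcancel hIF hJF (by rw [hgIJ, Ideal.span_singleton_neg])
      subst hIJ
      have hz : gen I = 0 := add_self_eq_zero.1 (eq_neg_iff_add_eq_zero.1 hgIJ)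
      exact absurd hz (hgen0 I hIF)
  -- the image is an admissible set of lattice points
  set T : Finset (ℤ × ℤ) := (F ×ˢ (univ : Finset Bool)).image pt with hT
  have hTadm : ∀ v ∈ T, v ≠ 0 ∧ A * v.1 ^ 2 + Bq * v.1 * v.2 + C * v.2 ^ 2 ≤ N := by
    intro v hv
    obtain ⟨Is, hIs, rfl⟩ := mem_image.1 hv
    have hI : Is.1 ∈ F := (mem_product.1 hIs).1
    obtain ⟨h1, h2⟩ := hevI Is.1 hI
    obtain ⟨-, hIN, -⟩ := hFmem Is.1 hI
    have hev' : ev (pt Is) = ev ((co Is.1).1, -(co Is.1).2) := hpt_ev Is hIs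
    refine ⟨fun h0 => ?_, ?_⟩
    · have : ev (pt Is) = 0 := by rw [h0, hev]; simp
      omega
    · change ev (pt Is) ≤ N
      rw [hev']
      exact h2.trans (by exact_mod_cast hIN)
  have hBQ := hB Q hQ T hTadm
  -- compare the sums
  have hsumF : ∑ Is ∈ F ×ˢ (univ : Finset Bool), (1 : ℝ) / (Ideal.absNorm Is.1 : ℝ) = 2 * G (cQ Q) := by
    rw [sum_product]
    simp only [sum_const, card_univ, Fintype.card_bool, nsmul_eq_mul, Nat.cast_ofNat]
    rw [← mul_sum]
  have hle1 : ∑ Is ∈ F ×ˢ (univ : Finset Bool), (1 : ℝ) / (Ideal.absNorm Is.1 : ℝ) ≤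
      ∑ Is ∈ F ×ˢ (univ : Finset Bool), (1 : ℝ) / (ev (pt Is) : ℝ) := by
    refine sum_le_sum fun Is hIs => ?_
    have hI : Is.1 ∈ F := (mem_product.1 hIs).1
    obtain ⟨h1, h2⟩ := hevI Is.1 hI
    rw [hpt_ev Is hIs]
    have h1' : (1 : ℝ) ≤ (ev ((co Is.1).1, -(co Is.1).2) : ℝ) := by exact_mod_cast h1
    have h2' : (ev ((co Is.1).1, -(co Is.1).2) : ℝ) ≤ (Ideal.absNorm Is.1 : ℝ) := by exact_mod_cast h2
    exact one_div_le_one_div_of_le (by linarith) h2'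
  have hle2 : ∑ Is ∈ F ×ˢ (univ : Finset Bool), (1 : ℝ) / (ev (pt Is) : ℝ) =
      ∑ v ∈ T, (1 : ℝ) / (ev v : ℝ) := by
    rw [hT, sum_image hinj]
  have hBQ' : ∑ v ∈ T, (1 : ℝ) / (ev v : ℝ) ≤ B Q := hBQ
  linarith

end Literature.NumberTheory.QuadraticFields.Quadratic

end
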